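import Summits.QuantumFields.YangMills.Theorems.BalabanUVNodesN15KingModelTwoPointOptimalDecay
import Literature.Analysis.Quadrature.RiceSubtraction

/-!
# BalabanUVNodes ∕ N15 — THE KING-MODEL RUNG (PART Ϸ-i): THE EXACT ONE-LINE INTEGRAL `∫sinc²(x∕2)cos(xt+θ)∕(x²+M²)dx = cos θ·2π(cosh M − 1)e^{−M|t|}∕M³` (`|t| ≥ 1`)
# — Fejér's vanishing `∫sinc²(x∕2)cos(xt)dx = 0` off `[−1,1]`, the Picard∕Lorentzian transform `∫cos(xs)∕(x²+M²)dx = (π∕M)e^{−M|s|}`, partial fractions; and the EXACT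
# `p_ν`-integral of King's two-point integrand at fixed `p_⊥` (Track A, DAG node N15 = NE2; FAN-OUT v1.1 §N15 s3 «KING-MODEL RUNG»; sharpens part Ϸ-b∕c's BOUND to an
# IDENTITY; count-neutral)

HONEST FRAMING.  Count-neutral (cell `pub-ymgap`, seat `pub-ymgap-dag-n15-e` g34; `--supports stmt-QuantumFields-27366 --as helper` = K3⁸
`SpineGivenEndpointR13SepCoPHV`).  King's `A = 0`, `g = 0` model ([King1986] C. King, Commun. Math. Phys. **102** (1986) 649–677; the continuum two-point function
`S₂^{ℝ}(z) = (2π)^{−(d+1)}∫Π_μ sinc²(p_μ∕2)cos(p·z)∕(p²+m²)dp` of the `K = ∞` block field, (4.5) p.670, (4.36) p.674).  Parts Ϸ-b∕c BOUNDED the `p_ν`-line integral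
`∫sinc²(x∕2)cos(xζ+θ)∕(x²+M²)dx` by a Paley–Wiener contour shift (`≤ K(c,m)e^{−c|ζ|}` for every `c < m`).  This file COMPUTES it: for `|t| ≥ 1` (one lattice
spacing or more) and `M > 0`, `∫_ℝ sinc²(x∕2)cos(xt+θ)∕(x²+M²)dx = cos θ·2π(cosh M − 1)·e^{−M|t|}∕M³` — the optimal rate `e^{−M|t|}` with an explicit POSITIVE weight.
No residues are needed: (i) FEJÉR — the Fourier transform of `sinc²(x∕2)` is the triangle `(1−|v|)₊` ([ButzerNessel1971] (12.4.3)), and the only thing used here,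
its VANISHING off `[−1,1]`, follows from the three-term identity `sinc²(x∕2)cos(xt) = g_{t+1}(x) + g_{t−1}(x) − 2g_t(x)`, `g_c(x) = (1 − cos(cx))∕x²`, the scaling
`∫g_c = |c|∫g_1` and `|t+1| + |t−1| − 2|t| = 0` for `|t| ≥ 1` (the value `∫g_1 = π` is never needed); (ii) PICARD — `∫cos(au)∕(1+u²)du = πe^{−|a|}` is the tree's
`Literature.Analysis.Quadrature.LaplaceCosIntegral_holds` ([DavisRabinowitz1984] (3.3.1.3); [ButzerNessel1971] Problem 5.1.2), rescaled; (iii) partial fractions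
`sinc²(x∕2)∕(x²+M²) = M⁻²(sinc²(x∕2) − 2(1−cos x)∕(x²+M²))` and `2(1−cos x)cos(xt) = 2cos(xt) − cos(x(t+1)) − cos(x(t−1))`.  §5 reads it on King's integrand:
at fixed `p_⊥ = q`, for `|z_ν| ≥ 1`, `∫h_z(insertNth ν x q)dx = P(q)·cos(q·z_⊥)·2π(cosh M_q − 1)e^{−M_q|z_ν|}∕M_q³`, `M_q = √(|q|²+m²)`, `P(q) = Π_j sinc²(q_j∕2)` — the input of
part Ϸ-j (strict positivity on the axes and the EXACT correlation length `1∕m`).  NOT a node discharge (N15 is booked through n15-a's knit, untouched here); nothing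
Bałaban ∕ continuum-Yang–Mills ∕ `ℝ⁴` ∕ OS ∕ Clay.  0 `sorry`, 0 def; standard axioms.

WHAT THIS FILE PROVES (kernel).  §1 ★ `integral_cos_div_one_add_sq` (whole-line Picard), ★★ **`integral_cos_div_sq_add_sq`** (`∫cos(xs)∕(x²+M²)dx = (π∕M)e^{−M|s|}`),
`integrable_of_abs_le_inv_sq_add_sq`, `integrable_cos_div_sq_add_sq`.  §2 `sinc_sq_half_eq`, ★ `integrable_one_sub_cos_div_sq`, ★ `integral_one_sub_cos_div_sq_eq` (scaling),
`sinc_sq_half_mul_cos_eq`, `integrable_sinc_sq_half_mul_cos`, ★★ **`integral_sinc_sq_half_mul_cos_eq_zero`** (Fejér vanishing off `[−1,1]`).  §3 `sinc_sq_half_div_eq` (partial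
fractions), `integrable_sinc_sq_half_div_mul_cos∕sin`, ★★★ **`integral_sinc_sq_half_mul_cos_div_eq`** (the exact line integral), §4 `integral_sinc_sq_half_mul_sin_div_eq_zero` (odd part),
★★★ **`integral_sinc_sq_half_cos_div_eq`** (with phase), `integral_sinc_sq_half_cos_div_eq_of_pos` (`M² = M2 > 0` form).  §5 KING: ★★★ **`integral_twoPtIntegrand_insertNth_eq`** (the exact
`p_ν`-integral of `h_z` at fixed `p_⊥`, `|z_ν| ≥ 1`).

HONEST SCOPE.  One-dimensional real analysis + its reading on King's free-model integrand; `|t| ≥ 1` is essential (inside `[−1,1]` the Fejér term `2∫g_1·(1−|t|)` survives).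
N15 untouched; counts unmoved.  Locators (use): [King1986] (4.5) p.670, (4.36) p.674, Thm 3.3 (3.6) p.655; [ButzerNessel1971] (12.4.3), Problem 5.1.2; [DavisRabinowitz1984]
Sect. 3.3.1 (3.3.1.3).
-/

noncomputable section

open scoped BigOperators Topology
open Filter MeasureTheory Set

namespace Summit.QuantumFields.YangMills.BalabanUVNodes.N15KingModelRung.OptimalDecay

open Literature.Analysis.Quadrature (LaplaceCosIntegral LaplaceCosIntegral_holds)

/-! ## §1 The Picard ∕ Lorentzian cosine transform -/

/-- ★ **Whole-line Picard transform**: `∫_ℝ cos(au)∕(1+u²)du = πe^{−|a|}` (the tree's half-line (3.3.1.3), doubled by evenness).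
[cite: DavisRabinowitz1984, Sect. 3.3.1 (3.3.1.3)] [cite: ButzerNessel1971, Problem 5.1.2] -/
theorem integral_cos_div_one_add_sq (a : ℝ) : ∫ u : ℝ, Real.cos (a * u) / (1 + u ^ 2) = Real.pi * Real.exp (-|a|) := by
  have h : ∫ u in Ioi (0 : ℝ), Real.cos (a * u) / (1 + u ^ 2) = Real.pi / 2 * Real.exp (-|a|) := LaplaceCosIntegral_holds a
  have heven : (fun u : ℝ => Real.cos (a * |u|) / (1 + |u| ^ 2)) = fun u : ℝ => Real.cos (a * u) / (1 + u ^ 2) := by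
    funext u
    rw [sq_abs]
    rcases le_or_gt 0 u with hu | hu
    · rw [abs_of_nonneg hu]
    · rw [abs_of_neg hu, mul_neg, Real.cos_neg]
  have h2 := integral_comp_abs (f := fun u : ℝ => Real.cos (a * u) / (1 + u ^ 2))
  rw [heven] at h2
  rw [h2, h]
  ring

/-- ★★ **The Lorentzian cosine transform**: for `M > 0`, `∫_ℝ cos(xs)∕(x²+M²)dx = (π∕M)e^{−M|s|}` (substitute `x = Mu`). [cite: ButzerNessel1971, Problem 5.1.2]
[cite: DavisRabinowitz1984, Sect. 3.3.1 (3.3.1.3)] -/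
theorem integral_cos_div_sq_add_sq {M : ℝ} (hM : 0 < M) (s : ℝ) :
    ∫ x : ℝ, Real.cos (x * s) / (x ^ 2 + M ^ 2) = Real.pi / M * Real.exp (-(M * |s|)) := by
  have hM0 : M ≠ 0 := hM.ne'
  set g : ℝ → ℝ := fun u => (M ^ 2)⁻¹ * (Real.cos ((M * s) * u) / (1 + u ^ 2)) with hg
  have hpt : (fun x : ℝ => Real.cos (x * s) / (x ^ 2 + M ^ 2)) = fun x => g (M⁻¹ * x) := by
    funext x
    simp only [hg]
    rw [show M * s * (M⁻¹ * x) = x * s by field_simp]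
    have h1 : (1 + (M⁻¹ * x) ^ 2) = (x ^ 2 + M ^ 2) / M ^ 2 := by
      field_simp
      ring
    rw [h1]
    have hD : x ^ 2 + M ^ 2 ≠ 0 := by positivity
    field_simp
  rw [hpt, Measure.integral_comp_mul_left g M⁻¹, inv_inv, abs_of_pos hM, smul_eq_mul, hg, integral_const_mul, integral_cos_div_one_add_sq,
    abs_mul, abs_of_pos hM]
  field_simp

/-- A continuous function dominated by the Lorentzian `(x²+M²)⁻¹` is integrable. [folklore] -/
theorem integrable_of_abs_le_inv_sq_add_sq {M : ℝ} (hM : 0 < M) {f : ℝ → ℝ} (hf : Continuous f) (hle : ∀ x, |f x| ≤ 1 / (x ^ 2 + M ^ 2)) :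
    Integrable f := by
  refine ((integrable_inv_one_add_sq).const_mul ((1 + M ^ 2) / M ^ 2)).mono' hf.aestronglyMeasurable (Eventually.of_forall fun x => ?_)
  rw [Real.norm_eq_abs]
  refine (hle x).trans ?_
  have hD : 0 < x ^ 2 + M ^ 2 := by positivity
  have hM2 : 0 < M ^ 2 := by positivity
  rw [← div_eq_mul_inv, div_le_div_iff₀ hD (by positivity), div_mul_eq_mul_div, le_div_iff₀ hM2]
  nlinarith [sq_nonneg (M ^ 2), sq_nonneg x, mul_pos hM2 hM2]

/-- `cos(xs)∕(x²+M²)` is integrable (`M > 0`). [folklore] -/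
theorem integrable_cos_div_sq_add_sq {M : ℝ} (hM : 0 < M) (s : ℝ) : Integrable fun x : ℝ => Real.cos (x * s) / (x ^ 2 + M ^ 2) := by
  refine integrable_of_abs_le_inv_sq_add_sq hM (Continuous.div (by fun_prop) (by fun_prop) fun x => by positivity) fun x => ?_
  have hD : 0 < x ^ 2 + M ^ 2 := by positivity
  rw [abs_div, abs_of_pos hD]
  exact div_le_div_of_nonneg_right (Real.abs_cos_le_one _) hD.le

/-! ## §2 Fejér: `∫sinc²(x∕2)cos(xt)dx = 0` for `|t| ≥ 1` -/

/-- `sinc²(x∕2) = 2(1 − cos x)∕x²` for `x ≠ 0` (the same identity is `Summit.AtomisticToContinuum.BoseEinsteinCondensation.Theorems.CoreDeficitBounds.sinc_half_sq` in another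
summit tree, not importable here; restated). [cite: ButzerNessel1971, (12.4.3)] -/
theorem sinc_sq_half_eq {x : ℝ} (hx : x ≠ 0) : Real.sinc (x / 2) ^ 2 = 2 * (1 - Real.cos x) / x ^ 2 := by
  rw [Real.sinc_of_ne_zero (div_ne_zero hx two_ne_zero), div_pow]
  have hc : Real.cos x = 2 * Real.cos (x / 2) ^ 2 - 1 := by
    rw [← Real.cos_two_mul]
    congr 1
    ring
  have hs : Real.sin (x / 2) ^ 2 = 1 - Real.cos (x / 2) ^ 2 := by
    have := Real.sin_sq_add_cos_sq (x / 2)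
    linarith
  rw [hs, hc]
  field_simp
  ring

/-- ★ `g_c(x) = (1 − cos(cx))∕x²` is integrable on `ℝ` (`≤ (c²+4)(1+x²)⁻¹`). [folklore] -/
theorem integrable_one_sub_cos_div_sq (c : ℝ) : Integrable fun x : ℝ => (1 - Real.cos (c * x)) / x ^ 2 := by
  refine ((integrable_inv_one_add_sq).const_mul (c ^ 2 + 4)).mono' ?_ (Eventually.of_forall fun x => ?_)
  · exact (by fun_prop : Measurable fun x : ℝ => (1 - Real.cos (c * x)) / x ^ 2).aestronglyMeasurable
  · have h0 : 0 ≤ 1 - Real.cos (c * x) := by linarith [Real.cos_le_one (c * x)]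
    have h2 : 1 - Real.cos (c * x) ≤ 2 := by linarith [Real.neg_one_le_cos (c * x)]
    rw [Real.norm_eq_abs, abs_of_nonneg (div_nonneg h0 (sq_nonneg x))]
    rcases eq_or_ne x 0 with rfl | hx
    · simp
      positivity
    have hx2 : 0 < x ^ 2 := by positivity
    rw [← div_eq_mul_inv, div_le_div_iff₀ hx2 (by positivity)]
    rcases le_or_gt (|x|) 1 with h1 | h1
    · have hb : 1 - Real.cos (c * x) ≤ (c * x) ^ 2 / 2 := by linarith [Real.one_sub_sq_div_two_le_cos (x := c * x)]
      have hx1 : x ^ 2 ≤ 1 := by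
        rw [← sq_abs]
        exact pow_le_one₀ (abs_nonneg x) h1
      nlinarith [mul_le_mul_of_nonneg_right hb (by positivity : (0 : ℝ) ≤ 1 + x ^ 2),
        mul_le_mul_of_nonneg_left hx1 (by positivity : (0 : ℝ) ≤ c ^ 2 * x ^ 2)]
    · have hx1 : 1 ≤ x ^ 2 := by
        rw [← sq_abs]
        nlinarith
      nlinarith [mul_le_mul_of_nonneg_right h2 (by positivity : (0 : ℝ) ≤ 1 + x ^ 2), sq_nonneg c]

/-- ★ **Scaling**: `∫(1 − cos(cx))∕x²dx = |c|·∫(1 − cos x)∕x²dx` (substitute `y = cx`; both sides vanish at `c = 0`). [cite: ButzerNessel1971, (12.4.3)] -/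
theorem integral_one_sub_cos_div_sq_eq (c : ℝ) :
    ∫ x : ℝ, (1 - Real.cos (c * x)) / x ^ 2 = |c| * ∫ x : ℝ, (1 - Real.cos x) / x ^ 2 := by
  rcases eq_or_ne c 0 with rfl | hc
  · simp
  have hpt : (fun x : ℝ => (1 - Real.cos (c * x)) / x ^ 2) = fun x => c ^ 2 * ((fun y : ℝ => (1 - Real.cos y) / y ^ 2) (c * x)) := by
    funext x
    simp only
    rw [mul_pow]
    rcases eq_or_ne x 0 with rfl | hx
    · simp
    · field_simp
  rw [hpt, integral_const_mul, Measure.integral_comp_mul_left (fun y : ℝ => (1 - Real.cos y) / y ^ 2) c, smul_eq_mul, abs_inv,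
    show c ^ 2 = |c| ^ 2 from (sq_abs c).symm]
  have hc' : |c| ≠ 0 := abs_ne_zero.mpr hc
  field_simp

/-- The three-term identity: `sinc²(x∕2)cos(xt) = g_{t+1}(x) + g_{t−1}(x) − 2g_t(x)` for `x ≠ 0`, `g_c(x) = (1 − cos(cx))∕x²`. [folklore] -/
theorem sinc_sq_half_mul_cos_eq {x : ℝ} (hx : x ≠ 0) (t : ℝ) :
    Real.sinc (x / 2) ^ 2 * Real.cos (x * t)
      = (1 - Real.cos ((t + 1) * x)) / x ^ 2 + (1 - Real.cos ((t - 1) * x)) / x ^ 2 - 2 * ((1 - Real.cos (t * x)) / x ^ 2) := by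
  rw [sinc_sq_half_eq hx]
  have h1 : Real.cos ((t + 1) * x) = Real.cos (t * x) * Real.cos x - Real.sin (t * x) * Real.sin x := by rw [add_mul, one_mul, Real.cos_add]
  have h2 : Real.cos ((t - 1) * x) = Real.cos (t * x) * Real.cos x + Real.sin (t * x) * Real.sin x := by rw [sub_mul, one_mul, Real.cos_sub]
  rw [h1, h2, mul_comm x t]
  field_simp
  ring

/-- `sinc²(x∕2)cos(xt)` is integrable. [folklore] -/
theorem integrable_sinc_sq_half_mul_cos (t : ℝ) : Integrable fun x : ℝ => Real.sinc (x / 2) ^ 2 * Real.cos (x * t) := by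
  refine ((integrable_inv_one_add_sq).const_mul (17 + 16 * Real.pi ^ 2)).mono' (by fun_prop : Continuous fun x : ℝ => Real.sinc (x / 2) ^ 2 * Real.cos (x * t)).aestronglyMeasurable
    (Eventually.of_forall fun x => ?_)
  rw [Real.norm_eq_abs, abs_mul, abs_of_nonneg (sq_nonneg _)]
  calc Real.sinc (x / 2) ^ 2 * |Real.cos (x * t)| ≤ Real.sinc (x / 2) ^ 2 * 1 := mul_le_mul_of_nonneg_left (Real.abs_cos_le_one _) (sq_nonneg _)
    _ ≤ (17 + 16 * Real.pi ^ 2) * (1 + x ^ 2)⁻¹ := by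
        rw [mul_one]
        exact sinc_sq_half_window (s := x) (t := x) (by simp; positivity)

/-- ★★ **FEJÉR'S VANISHING**: for `|t| ≥ 1`, `∫_ℝ sinc²(x∕2)cos(xt)dx = 0` — the Fourier transform of `sinc²(x∕2)` is the triangle `(1−|v|)₊`, supported in `[−1,1]`;
here only `∫g_c = |c|∫g_1` and `|t+1| + |t−1| − 2|t| = 0` are used. [cite: ButzerNessel1971, (12.4.3)] -/
theorem integral_sinc_sq_half_mul_cos_eq_zero {t : ℝ} (ht : 1 ≤ |t|) : ∫ x : ℝ, Real.sinc (x / 2) ^ 2 * Real.cos (x * t) = 0 := by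
  have h0 : ∀ᵐ x : ℝ ∂volume, x ≠ 0 := by
    simp [ae_iff]
  have hae : (fun x : ℝ => Real.sinc (x / 2) ^ 2 * Real.cos (x * t))
      =ᵐ[volume] fun x => ((1 - Real.cos ((t + 1) * x)) / x ^ 2 + (1 - Real.cos ((t - 1) * x)) / x ^ 2) - 2 * ((1 - Real.cos (t * x)) / x ^ 2) := by
    filter_upwards [h0] with x hx using sinc_sq_half_mul_cos_eq hx t
  have hA := integrable_one_sub_cos_div_sq (t + 1)
  have hB := integrable_one_sub_cos_div_sq (t - 1)
  have hC := integrable_one_sub_cos_div_sq t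
  have hAB : Integrable fun x : ℝ => (1 - Real.cos ((t + 1) * x)) / x ^ 2 + (1 - Real.cos ((t - 1) * x)) / x ^ 2 := hA.add hB
  have hC2 : Integrable fun x : ℝ => 2 * ((1 - Real.cos (t * x)) / x ^ 2) := hC.const_mul 2
  rw [integral_congr_ae hae, integral_sub hAB hC2, integral_add hA hB, integral_const_mul,
    integral_one_sub_cos_div_sq_eq (t + 1), integral_one_sub_cos_div_sq_eq (t - 1), integral_one_sub_cos_div_sq_eq t]
  have key : |t + 1| + |t - 1| - 2 * |t| = 0 := by
    rcases le_or_gt 0 t with h | h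
    · rw [abs_of_nonneg h] at ht
      rw [abs_of_nonneg h, abs_of_nonneg (by linarith : (0 : ℝ) ≤ t + 1), abs_of_nonneg (by linarith : (0 : ℝ) ≤ t - 1)]
      ring
    · rw [abs_of_neg h] at ht
      rw [abs_of_neg h, abs_of_nonpos (by linarith : t + 1 ≤ 0), abs_of_neg (by linarith : t - 1 < 0)]
      ring
  set I := ∫ x : ℝ, (1 - Real.cos x) / x ^ 2
  linear_combination I * key

/-! ## §3 The exact line integral -/

/-- **Partial fractions** (all `x`): `sinc²(x∕2)∕(x²+M²) = M⁻²(sinc²(x∕2) − 2(1−cos x)∕(x²+M²))`. [folklore] -/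
theorem sinc_sq_half_div_eq {M : ℝ} (hM : 0 < M) (x : ℝ) :
    Real.sinc (x / 2) ^ 2 / (x ^ 2 + M ^ 2) = (M ^ 2)⁻¹ * (Real.sinc (x / 2) ^ 2 - 2 * (1 - Real.cos x) / (x ^ 2 + M ^ 2)) := by
  have hD : x ^ 2 + M ^ 2 ≠ 0 := by positivity
  have hM0 : M ≠ 0 := hM.ne'
  rcases eq_or_ne x 0 with rfl | hx
  · simp
  · rw [sinc_sq_half_eq hx]
    field_simp
    ring

/-- `x ↦ sinc²(x∕2)∕(x²+M²)` is continuous (`M > 0`). [folklore] -/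
theorem continuous_sinc_sq_half_div {M : ℝ} (hM : 0 < M) : Continuous fun x : ℝ => Real.sinc (x / 2) ^ 2 / (x ^ 2 + M ^ 2) :=
  Continuous.div (by fun_prop) (by fun_prop) fun x => by positivity

/-- `sinc²(x∕2)cos(xt+θ)∕(x²+M²)` is integrable (`M > 0`). [folklore] -/
theorem integrable_sinc_sq_half_div_mul_cos {M : ℝ} (hM : 0 < M) (t θ : ℝ) :
    Integrable fun x : ℝ => Real.sinc (x / 2) ^ 2 / (x ^ 2 + M ^ 2) * Real.cos (x * t + θ) := by
  refine integrable_of_abs_le_inv_sq_add_sq hM ((continuous_sinc_sq_half_div hM).mul (by fun_prop)) fun x => ?_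
  have hD : 0 < x ^ 2 + M ^ 2 := by positivity
  rw [abs_mul, abs_div, abs_of_pos hD, abs_of_nonneg (sq_nonneg _)]
  have hs : Real.sinc (x / 2) ^ 2 ≤ 1 := by
    rw [← sq_abs]
    exact pow_le_one₀ (abs_nonneg _) (Real.abs_sinc_le_one _)
  calc Real.sinc (x / 2) ^ 2 / (x ^ 2 + M ^ 2) * |Real.cos (x * t + θ)| ≤ 1 / (x ^ 2 + M ^ 2) * 1 :=
        mul_le_mul (div_le_div_of_nonneg_right hs hD.le) (Real.abs_cos_le_one _) (abs_nonneg _) (by positivity)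
    _ = 1 / (x ^ 2 + M ^ 2) := mul_one _

/-- `sinc²(x∕2)sin(xt)∕(x²+M²)` is integrable (`M > 0`). [folklore] -/
theorem integrable_sinc_sq_half_div_mul_sin {M : ℝ} (hM : 0 < M) (t : ℝ) :
    Integrable fun x : ℝ => Real.sinc (x / 2) ^ 2 / (x ^ 2 + M ^ 2) * Real.sin (x * t) := by
  refine integrable_of_abs_le_inv_sq_add_sq hM ((continuous_sinc_sq_half_div hM).mul (by fun_prop)) fun x => ?_
  have hD : 0 < x ^ 2 + M ^ 2 := by positivity
  rw [abs_mul, abs_div, abs_of_pos hD, abs_of_nonneg (sq_nonneg _)]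
  have hs : Real.sinc (x / 2) ^ 2 ≤ 1 := by
    rw [← sq_abs]
    exact pow_le_one₀ (abs_nonneg _) (Real.abs_sinc_le_one _)
  calc Real.sinc (x / 2) ^ 2 / (x ^ 2 + M ^ 2) * |Real.sin (x * t)| ≤ 1 / (x ^ 2 + M ^ 2) * 1 :=
        mul_le_mul (div_le_div_of_nonneg_right hs hD.le) (Real.abs_sin_le_one _) (abs_nonneg _) (by positivity)
    _ = 1 / (x ^ 2 + M ^ 2) := mul_one _

/-- ★★★ **THE EXACT LINE INTEGRAL**: for `M > 0` and `|t| ≥ 1`, `∫_ℝ sinc²(x∕2)cos(xt)∕(x²+M²)dx = 2π(cosh M − 1)e^{−M|t|}∕M³` (partial fractions; Fejér kills the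
`M⁻²∫sinc²cos`; three Lorentzian transforms at `t, t ± 1`; `e^{−M(|t|+1)} + e^{−M(|t|−1)} − 2e^{−M|t|} = 2(cosh M − 1)e^{−M|t|}`). [cite: ButzerNessel1971, (12.4.3), Problem 5.1.2] -/
theorem integral_sinc_sq_half_mul_cos_div_eq {M t : ℝ} (hM : 0 < M) (ht : 1 ≤ |t|) :
    ∫ x : ℝ, Real.sinc (x / 2) ^ 2 / (x ^ 2 + M ^ 2) * Real.cos (x * t) = 2 * Real.pi * (Real.cosh M - 1) / M ^ 3 * Real.exp (-(M * |t|)) := by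
  have hM0 : M ≠ 0 := hM.ne'
  have hpt : (fun x : ℝ => Real.sinc (x / 2) ^ 2 / (x ^ 2 + M ^ 2) * Real.cos (x * t))
      = fun x => (M ^ 2)⁻¹ * (Real.sinc (x / 2) ^ 2 * Real.cos (x * t)
          - ((2 * (Real.cos (x * t) / (x ^ 2 + M ^ 2)) - Real.cos (x * (t + 1)) / (x ^ 2 + M ^ 2)) - Real.cos (x * (t - 1)) / (x ^ 2 + M ^ 2))) := by
    funext x
    rw [sinc_sq_half_div_eq hM x]
    have h1 : Real.cos (x * (t + 1)) = Real.cos (x * t) * Real.cos x - Real.sin (x * t) * Real.sin x := by rw [mul_add, mul_one, Real.cos_add]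
    have h2 : Real.cos (x * (t - 1)) = Real.cos (x * t) * Real.cos x + Real.sin (x * t) * Real.sin x := by rw [mul_sub, mul_one, Real.cos_sub]
    rw [h1, h2]
    have hD : x ^ 2 + M ^ 2 ≠ 0 := by positivity
    field_simp
    ring
  have hI0 : Integrable fun x : ℝ => 2 * (Real.cos (x * t) / (x ^ 2 + M ^ 2)) := (integrable_cos_div_sq_add_sq hM t).const_mul 2
  have hI1 := integrable_cos_div_sq_add_sq hM (t + 1)
  have hI2 := integrable_cos_div_sq_add_sq hM (t - 1)
  have hI01 : Integrable fun x : ℝ => 2 * (Real.cos (x * t) / (x ^ 2 + M ^ 2)) - Real.cos (x * (t + 1)) / (x ^ 2 + M ^ 2) := hI0.sub hI1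
  have hI012 : Integrable fun x : ℝ => (2 * (Real.cos (x * t) / (x ^ 2 + M ^ 2)) - Real.cos (x * (t + 1)) / (x ^ 2 + M ^ 2)) - Real.cos (x * (t - 1)) / (x ^ 2 + M ^ 2) :=
    hI01.sub hI2
  rw [hpt, integral_const_mul, integral_sub (integrable_sinc_sq_half_mul_cos t) hI012, integral_sub hI01 hI2, integral_sub hI0 hI1, integral_const_mul,
    integral_sinc_sq_half_mul_cos_eq_zero ht, integral_cos_div_sq_add_sq hM t, integral_cos_div_sq_add_sq hM (t + 1), integral_cos_div_sq_add_sq hM (t - 1)]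
  -- `e^{−M|t+1|} + e^{−M|t−1|} = e^{−M|t|}(e^{M} + e^{−M})`
  have key : Real.exp (-(M * |t + 1|)) + Real.exp (-(M * |t - 1|)) = Real.exp (-(M * |t|)) * (Real.exp M + Real.exp (-M)) := by
    rw [mul_add, ← Real.exp_add, ← Real.exp_add]
    rcases le_or_gt 0 t with h | h
    · rw [abs_of_nonneg h] at ht
      rw [abs_of_nonneg h, abs_of_nonneg (by linarith : (0 : ℝ) ≤ t + 1), abs_of_nonneg (by linarith : (0 : ℝ) ≤ t - 1)]
      ring_nf
    · rw [abs_of_neg h] at ht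
      rw [abs_of_neg h, abs_of_nonpos (by linarith : t + 1 ≤ 0), abs_of_neg (by linarith : t - 1 < 0)]
      ring_nf
  rw [Real.cosh_eq]
  field_simp
  linear_combination Real.pi * key

/-! ## §4 The odd part and the phase -/

/-- The odd part vanishes: `∫sinc²(x∕2)sin(xt)∕(x²+M2)dx = 0` (the integrand is odd; `x ↦ −x` preserves Lebesgue measure). [folklore] -/
theorem integral_sinc_sq_half_mul_sin_div_eq_zero (M2 t : ℝ) : ∫ x : ℝ, Real.sinc (x / 2) ^ 2 / (x ^ 2 + M2) * Real.sin (x * t) = 0 := by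
  set f : ℝ → ℝ := fun x => Real.sinc (x / 2) ^ 2 / (x ^ 2 + M2) * Real.sin (x * t) with hf
  have hodd : (fun x => f (-x)) = fun x => -f x := by
    funext x
    simp only [hf, neg_div, Real.sinc_neg, neg_mul, Real.sin_neg, neg_sq, mul_neg]
  have h := integral_neg_eq_self f volume
  rw [hodd, integral_neg] at h
  show ∫ x, f x = 0
  linarith

/-- ★★★ **THE EXACT LINE INTEGRAL WITH PHASE**: for `M > 0`, `|t| ≥ 1`, every `θ`, `∫_ℝ sinc²(x∕2)cos(xt+θ)∕(x²+M²)dx = cos θ·2π(cosh M − 1)e^{−M|t|}∕M³`.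
[cite: ButzerNessel1971, (12.4.3), Problem 5.1.2] -/
theorem integral_sinc_sq_half_cos_div_eq {M t : ℝ} (hM : 0 < M) (ht : 1 ≤ |t|) (θ : ℝ) :
    ∫ x : ℝ, Real.sinc (x / 2) ^ 2 / (x ^ 2 + M ^ 2) * Real.cos (x * t + θ)
      = Real.cos θ * (2 * Real.pi * (Real.cosh M - 1) / M ^ 3 * Real.exp (-(M * |t|))) := by
  have hpt : (fun x : ℝ => Real.sinc (x / 2) ^ 2 / (x ^ 2 + M ^ 2) * Real.cos (x * t + θ))
      = fun x => Real.cos θ * (Real.sinc (x / 2) ^ 2 / (x ^ 2 + M ^ 2) * Real.cos (x * t)) - Real.sin θ * (Real.sinc (x / 2) ^ 2 / (x ^ 2 + M ^ 2) * Real.sin (x * t)) := by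
    funext x
    rw [Real.cos_add]
    ring
  have hc := integrable_sinc_sq_half_div_mul_cos hM t 0
  simp only [add_zero] at hc
  rw [hpt, integral_sub (hc.const_mul _) ((integrable_sinc_sq_half_div_mul_sin hM t).const_mul _), integral_const_mul, integral_const_mul,
    integral_sinc_sq_half_mul_cos_div_eq hM ht, integral_sinc_sq_half_mul_sin_div_eq_zero]
  ring

/-- The `M² = M2 > 0` form: `∫sinc²(x∕2)cos(xt+θ)∕(x²+M2)dx = cos θ·2π(cosh √M2 − 1)e^{−√M2|t|}∕√M2³`. [cite: ButzerNessel1971, (12.4.3), Problem 5.1.2] -/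
theorem integral_sinc_sq_half_cos_div_eq_of_pos {M2 t : ℝ} (hM2 : 0 < M2) (ht : 1 ≤ |t|) (θ : ℝ) :
    ∫ x : ℝ, Real.sinc (x / 2) ^ 2 / (x ^ 2 + M2) * Real.cos (x * t + θ)
      = Real.cos θ * (2 * Real.pi * (Real.cosh (Real.sqrt M2) - 1) / Real.sqrt M2 ^ 3 * Real.exp (-(Real.sqrt M2 * |t|))) := by
  have h := integral_sinc_sq_half_cos_div_eq (Real.sqrt_pos.mpr hM2) ht θ
  rw [Real.sq_sqrt hM2.le] at h
  exact h

/-! ## §5 KING: the exact `p_ν`-integral of the two-point integrand at fixed `p_⊥` -/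

variable {d : ℕ}

/-- ★★★ **KING — THE EXACT ONE-LINE INTEGRAL AT FIXED `p_⊥`**: for `|z_ν| ≥ 1` and every `q ∈ ℝ^d`,
`∫h_z(insertNth ν x q)dx = P(q)·cos(Σ_j q_j z_{ν↑j})·2π(cosh M_q − 1)e^{−M_q|z_ν|}∕M_q³`, `M_q = √(|q|²+m²)`, `P(q) = Π_j sinc²(q_j∕2)` — part Ϸ-c's
`abs_inner_integral_le` as an IDENTITY. [cite: King1986, (4.5) p.670, (4.36) p.674, Thm 3.3 (3.6) p.655] -/
theorem integral_twoPtIntegrand_insertNth_eq {m2 : ℝ} (hm : 0 < m2) (z : Fin (d + 1) → ℤ) (ν : Fin (d + 1)) (hz : 1 ≤ |(z ν : ℝ)|) (q : Fin d → ℝ) :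
    ∫ x : ℝ, twoPtIntegrand m2 z (Fin.insertNth ν x q)
      = (∏ j, Real.sinc (q j / 2) ^ 2) * (Real.cos (∑ j, q j * z (ν.succAbove j))
          * (2 * Real.pi * (Real.cosh (Real.sqrt ((∑ j, q j ^ 2) + m2)) - 1) / Real.sqrt ((∑ j, q j ^ 2) + m2) ^ 3
              * Real.exp (-(Real.sqrt ((∑ j, q j ^ 2) + m2) * |(z ν : ℝ)|)))) := by
  simp_rw [twoPtIntegrand_insertNth]
  rw [integral_const_mul, integral_sinc_sq_half_cos_div_eq_of_pos (by positivity) hz]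

end Summit.QuantumFields.YangMills.BalabanUVNodes.N15KingModelRung.OptimalDecay
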